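import Mathlib

/-!
# Locality of power-trace jumps for nearest-neighbour matrices

Stub `stub_tracePowLocality` for the line `weyl-window` of
`Summit.QuantumFields.QCD.Theses.SpectralDefectExtinction.ExtinctionBuildsQCD`.

Abstract combinatorial heart of the Weyl-window argument: `ι` is a finite index type with a
symmetric "distance" `d` satisfying the triangle inequality, `A₁, B₁, A₂, B₂` are
nearest-neighbour matrices (entries vanish when `d > 1`), each modification `Aᵢ ↦ Bᵢ` is
invisible on entries with both indices farther than `R` from a centre `p₀`, and the two pairs
coincide on entries with both indices within `R + ℓ` of `p₀`.  Then the jumps of the power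
traces `Tr (Bᵢ ^ k) - Tr (Aᵢ ^ k)` agree for `k ≤ ℓ`.

Proof: the telescoping identity `B ^ k - A ^ k = ∑_{j<k} B ^ j (B - A) A ^ (k-1-j)`, cyclicity
of the trace, the fact that `E := B₁ - A₁ = B₂ - A₂` is supported on the ball of radius
`R + 1`, and agreement of the mixed products `Aᵢ ^ a * Bᵢ ^ b` on the ball of radius `s`
whenever `a + b + s ≤ R + ℓ` (peeling nearest-neighbour factors from the left).
-/

open Finset

namespace Summit.QuantumFields.QCD.Cruxes.ExtinctionBuildsQCD.WeylWindow

/-! ### Noncommutative telescoping -/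

/-- Noncommutative telescoping: `b ^ k - a ^ k = ∑_{j < k} b ^ j * (b - a) * a ^ (k - 1 - j)`. -/
private theorem pow_sub_pow_telescope {S : Type*} [Ring S] (a b : S) (k : ℕ) :
    b ^ k - a ^ k = ∑ j ∈ range k, b ^ j * (b - a) * a ^ (k - 1 - j) := by
  induction k with
  | zero => simp
  | succ k ih =>
    rw [sum_range_succ, Nat.add_sub_cancel, Nat.sub_self, pow_zero, mul_one]
    have h1 : ∑ j ∈ range k, b ^ j * (b - a) * a ^ (k - j)
        = (∑ j ∈ range k, b ^ j * (b - a) * a ^ (k - 1 - j)) * a := by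
      rw [sum_mul]
      refine sum_congr rfl (fun j hj => ?_)
      rw [mem_range] at hj
      have hkj : k - j = (k - 1 - j) + 1 := by omega
      rw [hkj, pow_succ, ← mul_assoc]
    rw [h1, ← ih, pow_succ, pow_succ, sub_mul, mul_sub]
    abel

/-! ### Agreement on balls is propagated through nearest-neighbour products -/

/-- Product step: if the left factors are nearest-neighbour and both pairs of factors agree on
the ball of radius `σ + 1` around `p₀`, the products agree on the ball of radius `σ`. -/
private theorem agree_mul {ι : Type*} [Fintype ι] (d : ι → ι → ℕ)
    (hsymm : ∀ p q, d p q = d q p) (htri : ∀ p q r, d p r ≤ d p q + d q r) (p₀ : ι) (σ : ℕ)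
    (M M' X X' : Matrix ι ι ℂ)
    (hM : ∀ p q, 1 < d p q → M p q = 0) (hM' : ∀ p q, 1 < d p q → M' p q = 0)
    (hMM : ∀ p q, d p p₀ ≤ σ + 1 → d q p₀ ≤ σ + 1 → M p q = M' p q)
    (hXX : ∀ p q, d p p₀ ≤ σ + 1 → d q p₀ ≤ σ + 1 → X p q = X' p q) :
    ∀ p q, d p p₀ ≤ σ → d q p₀ ≤ σ → (M * X) p q = (M' * X') p q := by
  intro p q hp hq
  rw [Matrix.mul_apply, Matrix.mul_apply]
  refine sum_congr rfl (fun r _ => ?_)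
  by_cases hpr : 1 < d p r
  · rw [hM p r hpr, hM' p r hpr, zero_mul, zero_mul]
  · have hr : d r p₀ ≤ σ + 1 := by
      have h1 := htri r p p₀
      have h2 := hsymm r p
      omega
    rw [hMM p r (by omega) hr, hXX r q hr (by omega)]

/-- Powers of nearest-neighbour matrices agreeing on the ball of radius `T` agree on the ball
of radius `s` whenever `j + s ≤ T`. -/
private theorem agree_pow {ι : Type*} [Fintype ι] [DecidableEq ι] (d : ι → ι → ℕ)
    (hsymm : ∀ p q, d p q = d q p) (htri : ∀ p q r, d p r ≤ d p q + d q r) (p₀ : ι) (T : ℕ)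
    (B B' : Matrix ι ι ℂ)
    (hB : ∀ p q, 1 < d p q → B p q = 0) (hB' : ∀ p q, 1 < d p q → B' p q = 0)
    (hBB : ∀ p q, d p p₀ ≤ T → d q p₀ ≤ T → B p q = B' p q) :
    ∀ j s : ℕ, j + s ≤ T →
      ∀ p q, d p p₀ ≤ s → d q p₀ ≤ s → (B ^ j) p q = (B' ^ j) p q := by
  intro j
  induction j with
  | zero =>
    intro s _ p q _ _
    simp only [pow_zero]
  | succ j ih =>
    intro s hs
    rw [pow_succ', pow_succ']
    exact agree_mul d hsymm htri p₀ s B B' (B ^ j) (B' ^ j) hB hB'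
      (fun p q hp hq => hBB p q (by omega) (by omega)) (ih (s + 1) (by omega))

/-- Mixed products `A ^ i * B ^ j` of nearest-neighbour matrices agreeing on the ball of radius
`T` agree on the ball of radius `s` whenever `i + j + s ≤ T`. -/
private theorem agree_pow_mul_pow {ι : Type*} [Fintype ι] [DecidableEq ι] (d : ι → ι → ℕ)
    (hsymm : ∀ p q, d p q = d q p) (htri : ∀ p q r, d p r ≤ d p q + d q r) (p₀ : ι) (T : ℕ)
    (A A' B B' : Matrix ι ι ℂ)
    (hA : ∀ p q, 1 < d p q → A p q = 0) (hA' : ∀ p q, 1 < d p q → A' p q = 0)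
    (hB : ∀ p q, 1 < d p q → B p q = 0) (hB' : ∀ p q, 1 < d p q → B' p q = 0)
    (hAA : ∀ p q, d p p₀ ≤ T → d q p₀ ≤ T → A p q = A' p q)
    (hBB : ∀ p q, d p p₀ ≤ T → d q p₀ ≤ T → B p q = B' p q) :
    ∀ i j s : ℕ, i + j + s ≤ T →
      ∀ p q, d p p₀ ≤ s → d q p₀ ≤ s → (A ^ i * B ^ j) p q = (A' ^ i * B' ^ j) p q := by
  intro i
  induction i with
  | zero =>
    intro j s hs
    rw [pow_zero, pow_zero, one_mul, one_mul]
    exact agree_pow d hsymm htri p₀ T B B' hB hB' hBB j s (by omega)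
  | succ i ih =>
    intro j s hs
    rw [pow_succ', pow_succ', mul_assoc, mul_assoc]
    exact agree_mul d hsymm htri p₀ s A A' (A ^ i * B ^ j) (A' ^ i * B' ^ j) hA hA'
      (fun p q hp hq => hAA p q (by omega) (by omega)) (ih j (s + 1) (by omega))

/-! ### The perturbation `B - A` is the same for both pairs and supported near `p₀` -/

/-- When `1 ≤ ℓ`, the entrywise differences `B₁ - A₁` and `B₂ - A₂` coincide, and they vanish
unless both indices lie within `R + 1` of `p₀`. -/
private theorem diff_local {ι : Type*} (d : ι → ι → ℕ)
    (hsymm : ∀ p q, d p q = d q p) (htri : ∀ p q r, d p r ≤ d p q + d q r) (p₀ : ι) (R ℓ : ℕ)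
    (hℓ : 1 ≤ ℓ) (A₁ B₁ A₂ B₂ : Matrix ι ι ℂ)
    (hA₁ : ∀ p q, 1 < d p q → A₁ p q = 0) (hB₁ : ∀ p q, 1 < d p q → B₁ p q = 0)
    (hA₂ : ∀ p q, 1 < d p q → A₂ p q = 0) (hB₂ : ∀ p q, 1 < d p q → B₂ p q = 0)
    (hfar : ∀ p q, R < d p p₀ → R < d q p₀ → B₁ p q = A₁ p q ∧ B₂ p q = A₂ p q)
    (hnear : ∀ p q, d p p₀ ≤ R + ℓ → d q p₀ ≤ R + ℓ → A₂ p q = A₁ p q ∧ B₂ p q = B₁ p q)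
    (p q : ι) :
    B₁ p q - A₁ p q = B₂ p q - A₂ p q ∧
      (B₁ p q - A₁ p q ≠ 0 → d p p₀ ≤ R + 1 ∧ d q p₀ ≤ R + 1) := by
  by_cases h1 : 1 < d p q
  · rw [hA₁ p q h1, hB₁ p q h1, hA₂ p q h1, hB₂ p q h1]
    simp
  · by_cases hfar' : R < d p p₀ ∧ R < d q p₀
    · obtain ⟨e1, e2⟩ := hfar p q hfar'.1 hfar'.2
      rw [e1, e2]
      simp
    · have hpq : d p p₀ ≤ R + 1 ∧ d q p₀ ≤ R + 1 := by
        have t1 := htri p q p₀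
        have t2 := htri q p p₀
        have t3 := hsymm q p
        rcases not_and_or.mp hfar' with h | h <;> constructor <;> omega
      obtain ⟨hp', hq'⟩ := hpq
      obtain ⟨ea, eb⟩ := hnear p q (by omega) (by omega)
      rw [ea, eb]
      exact ⟨rfl, fun _ => ⟨hp', hq'⟩⟩

/-- If `E` is supported on `good × good` and `P₁, P₂` agree on `good × good`, then
`Tr (P₁ E) = Tr (P₂ E)`. -/
private theorem trace_mul_eq_of_support {ι : Type*} [Fintype ι] (good : ι → Prop)
    (P₁ P₂ E : Matrix ι ι ℂ) (hsupp : ∀ p q, E p q ≠ 0 → good p ∧ good q)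
    (hP : ∀ p q, good p → good q → P₁ p q = P₂ p q) :
    (P₁ * E).trace = (P₂ * E).trace := by
  simp only [Matrix.trace, Matrix.diag_apply, Matrix.mul_apply]
  refine sum_congr rfl (fun p _ => sum_congr rfl (fun q _ => ?_))
  by_cases h0 : E q p = 0
  · rw [h0, mul_zero, mul_zero]
  · obtain ⟨hq, hp⟩ := hsupp q p h0
    rw [hP p q hp hq]

/-! ### Main statement -/

/-- **Locality of power-trace jumps.**  For nearest-neighbour matrices (w.r.t. a symmetric `d`
with the triangle inequality) such that `Aᵢ ↦ Bᵢ` only changes entries with an index within `R`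
of `p₀`, and such that the two pairs `(A₁, B₁)`, `(A₂, B₂)` agree on entries with both indices
within `R + ℓ` of `p₀`, the jumps `Tr (Bᵢ ^ k) - Tr (Aᵢ ^ k)` coincide for all `k ≤ ℓ`. -/
theorem stub_tracePowLocality : ∀ (ι : Type) [Fintype ι] [DecidableEq ι] (d : ι → ι → ℕ), (∀ p q, d p q = d q p) → (∀ p q r, d p r ≤ d p q + d q r) → ∀ (p₀ : ι) (R ℓ : ℕ) (A₁ B₁ A₂ B₂ : Matrix ι ι ℂ), (∀ M ∈ [A₁, B₁, A₂, B₂], ∀ p q, 1 < d p q → M p q = 0) → (∀ p q, R < d p p₀ → R < d q p₀ → B₁ p q = A₁ p q ∧ B₂ p q = A₂ p q) → (∀ p q, d p p₀ ≤ R + ℓ → d q p₀ ≤ R + ℓ → A₂ p q = A₁ p q ∧ B₂ p q = B₁ p q) → ∀ k : ℕ, k ≤ ℓ → (B₁ ^ k).trace - (A₁ ^ k).trace = (B₂ ^ k).trace - (A₂ ^ k).trace := by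
  intro ι _ _ d hsymm htri p₀ R ℓ A₁ B₁ A₂ B₂ hNN hfar hnear k hk
  have hA₁ : ∀ p q, 1 < d p q → A₁ p q = 0 := hNN A₁ (by simp)
  have hB₁ : ∀ p q, 1 < d p q → B₁ p q = 0 := hNN B₁ (by simp)
  have hA₂ : ∀ p q, 1 < d p q → A₂ p q = 0 := hNN A₂ (by simp)
  have hB₂ : ∀ p q, 1 < d p q → B₂ p q = 0 := hNN B₂ (by simp)
  rw [← Matrix.trace_sub, ← Matrix.trace_sub, pow_sub_pow_telescope A₁ B₁ k,
    pow_sub_pow_telescope A₂ B₂ k, Matrix.trace_sum, Matrix.trace_sum]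
  refine sum_congr rfl (fun j hj => ?_)
  rw [mem_range] at hj
  have hℓ : 1 ≤ ℓ := by omega
  have hE : B₂ - A₂ = B₁ - A₁ := by
    ext p q
    rw [Matrix.sub_apply, Matrix.sub_apply]
    exact (diff_local d hsymm htri p₀ R ℓ hℓ A₁ B₁ A₂ B₂ hA₁ hB₁ hA₂ hB₂ hfar hnear p q).1.symm
  rw [hE, Matrix.trace_mul_cycle, Matrix.trace_mul_cycle (B₂ ^ j)]
  refine trace_mul_eq_of_support (fun p => d p p₀ ≤ R + 1) (A₁ ^ (k - 1 - j) * B₁ ^ j)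
    (A₂ ^ (k - 1 - j) * B₂ ^ j) (B₁ - A₁) ?_ ?_
  · intro p q hne
    exact (diff_local d hsymm htri p₀ R ℓ hℓ A₁ B₁ A₂ B₂ hA₁ hB₁ hA₂ hB₂ hfar hnear p q).2 hne
  · intro p q hp hq
    exact agree_pow_mul_pow d hsymm htri p₀ (R + ℓ) A₁ A₂ B₁ B₂ hA₁ hA₂ hB₁ hB₂
      (fun p q hp hq => (hnear p q hp hq).1.symm) (fun p q hp hq => (hnear p q hp hq).2.symm)
      (k - 1 - j) j (R + 1) (by omega) p q hp hq

end Summit.QuantumFields.QCD.Cruxes.ExtinctionBuildsQCD.WeylWindow
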